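import Summits.HubbardSuperconductivity.HubbardSuperconductivity.Theorems.AnisotropyChordTransferFibre3KT2bSupports
import Summits.HubbardSuperconductivity.HubbardSuperconductivity.Theorems.AnisotropyChordTransferFibre3IMS
import Summits.HubbardSuperconductivity.HubbardSuperconductivity.Theorems.AnisotropyChordTransferFibre3MinAttained
import Summits.HubbardSuperconductivity.HubbardSuperconductivity.Theorems.AnisotropyChordTransferFibre3PlaneWave

/-!
# Route `AnisotropyChord` / H0 rotor rung: the EXACT PAIR SPLIT of the `K₁` residual and `PairSplitCS` (PartN32) PROVED

Memo ROTOR-THEORY-20 §289(a)/§292(a), PartN32 = `…Fibre3KT2bTargets` (theory seat `hubbard-h0-rotor-theory-1`).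
For the trial state `Ψ¹ = vΠ⁰` (`Π⁰(a,b) = f(a)f(b)f(b−a)`, `v = 1 + e^{iθaₓ} + e^{iθbₓ}`):
* **`threeMoves`**: `H₀^{K₁}(vΠ) − v·H₀^{0}Π − ε₁vΠ = Σ_{e=±x̂} ½(1 − e^{iθe}) Σ_i φ_i [Π(x + e_i) − Π(x)]` — only the `x̂`-hops of
  each particle survive (`φ₁ = 1`, `φ₂ = e^{iθaₓ}`, `φ₃ = e^{iθbₓ}`);
* **`pairSplit_pointwise`** (for even `f`): the symmetric product rule splits this into `E₁₂(c) + E₁₂(b,a) + e^{iθaₓ}E₁₂(b−a,−a)`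
  with `E₁₂ = −½(d₊(a)A₊ + d₋(a)A₋)` (`E12raw`; `A_±` = `Aplus/Aminus` of PartN32), i.e. `E₁₃ = swap23 E₁₂`, `E₂₃ = U12 (swap23 E₁₂)`;
* **`resid_split`**: `R′ = v·C0′ + E₁₂ + E₁₃ + E₂₃` (all off-`D` restricted);
* **`sum_normSq_E12_le`**: `‖E₁₂‖² ≤ cs2` (Cauchy–Schwarz over the two groups), `‖E₁₃‖ = ‖E₂₃‖ = ‖E₁₂‖`;
* **`pairSplitCS_holds (hL : 2 ≤ L) (Δ) : PairSplitCS L Δ`** — `‖R′‖² ≤ (3√cs2 + ‖N‖)²` by the triangle inequality.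
Prover seat `hubbard-h0-rotor-p1` g22; helper for stmt-HubbardSuperconductivity-19089 (`--supports`).
-/

set_option linter.dupNamespace false
set_option autoImplicit false

noncomputable section

open scoped BigOperators
open Complex

namespace Summit.HubbardSuperconductivity.HubbardSuperconductivity.Theorems.AnisotropyChord.Transfer.Fibre3

variable (L : ℕ) [NeZero L]

/-! ## Small facts -/

omit [NeZero L] in
/-- `K₁ = x̂`. [folklore] -/
theorem K1_eq_ex : K1 L = ex L := rfl

/-- `ε₁ = 1 − (e^{iθ} + e^{−iθ})/2` in `ℂ` (`L ≥ 2`). [folklore] -/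
theorem eps1_eq_phase (hL : 2 ≤ L) :
    (eps1 L : ℂ) = 1 - (phase L (K1 L) (K1 L) + phase L (K1 L) (-(K1 L))) / 2 := by
  have : Fact (1 < L) := ⟨by omega⟩
  have h1 : (((ex L).1.val : ℕ) : ℝ) = 1 := by
    rw [show (ex L).1 = 1 from rfl, ZMod.val_one]; simp
  unfold eps1
  rw [K1_eq_ex, phase_ex_add_neg, h1, mul_one]
  push_cast
  ring

omit [NeZero L] in
/-- the hard core is invariant under `(a,b) ↦ (b − a, −a)`. [folklore] -/
theorem InD_rot (c : Cfg L) : InD L (c.2 - c.1, -c.1) = InD L c := by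
  have h := InD_swap L (-c.1, c.2 - c.1)
  rw [InD_U12] at h
  exact h

/-! ## Stage 1: only the `x̂`-hops survive -/

/-- **three moves**: `H₀^{K₁}(vΠ) − vH₀⁰Π − ε₁vΠ = ½w₊[ΔΠ₁(−x̂)+φ_aΔΠ₂(x̂)+φ_bΔΠ₃(x̂)] + ½w₋[mirror]`. [folklore] -/
theorem threeMoves (hL : 2 ≤ L) (f : Tor L → ℝ) (c : Cfg L) :
    H0apply L (K1 L) (trialK1 L f) c - vfun L c * H0apply L 0 (prodState L f) c - (eps1 L : ℂ) * trialK1 L f c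
      = (1 / 2 : ℂ) * wplus L *
          ((prodState L f (c.1 - K1 L, c.2 - K1 L) - prodState L f c)
            + phase L (K1 L) c.1 * (prodState L f (c.1 + K1 L, c.2) - prodState L f c)
            + phase L (K1 L) c.2 * (prodState L f (c.1, c.2 + K1 L) - prodState L f c))
        + (1 / 2 : ℂ) * wminus L *
          ((prodState L f (c.1 + K1 L, c.2 + K1 L) - prodState L f c)
            + phase L (K1 L) c.1 * (prodState L f (c.1 - K1 L, c.2) - prodState L f c)
            + phase L (K1 L) c.2 * (prodState L f (c.1, c.2 - K1 L) - prodState L f c)) := by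
  have hpq := phase_mul_neg L (K1 L) (K1 L)
  obtain ⟨hey1, hey2⟩ := phase_K1_ey L
  rw [eps1_eq_phase L hL, H0apply_four, H0apply_four]
  simp only [hopT, trialK1, vfun, wplus, wminus, ← K1_eq_ex, sub_eq_add_neg, neg_neg, phase_add, phase_zero_left,
    hey1, hey2, mul_one, one_mul]
  linear_combination (-(1 / 2 : ℂ)) * (phase L (K1 L) c.1 + phase L (K1 L) c.2)
    * (prodState L f (c.1 + -K1 L, c.2 + -K1 L) + prodState L f (c.1 + K1 L, c.2 + K1 L)) * hpq

/-! ## Stage 2: the symmetric product rule -/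

/-- the raw pair term `E⁰₁₂(c) = −½ (d₊(a) A₊(c) + d₋(a) A₋(c))`, `d₊(a) = f(a) − f(a−x̂)`, `d₋(a) = f(a) − f(a+x̂)`. [folklore] -/
def E12raw (f : Tor L → ℝ) (c : Cfg L) : ℂ :=
  -(1 / 2 : ℂ) * (((f c.1 - f (c.1 - K1 L) : ℝ) : ℂ) * Aplus L f c + ((f c.1 - f (c.1 + K1 L) : ℝ) : ℂ) * Aminus L f c)

/-- **the exact pair split, pointwise** (even `f`): three-move form `= E⁰₁₂(a,b) + E⁰₁₂(b,a) + e^{iθaₓ} E⁰₁₂(b−a,−a)`. [folklore] -/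
theorem pairSplit_pointwise {f : Tor L → ℝ} (hev : ∀ r : Tor L, f (-r) = f r) (c : Cfg L) :
    (1 / 2 : ℂ) * wplus L *
          ((prodState L f (c.1 - K1 L, c.2 - K1 L) - prodState L f c)
            + phase L (K1 L) c.1 * (prodState L f (c.1 + K1 L, c.2) - prodState L f c)
            + phase L (K1 L) c.2 * (prodState L f (c.1, c.2 + K1 L) - prodState L f c))
        + (1 / 2 : ℂ) * wminus L *
          ((prodState L f (c.1 + K1 L, c.2 + K1 L) - prodState L f c)
            + phase L (K1 L) c.1 * (prodState L f (c.1 - K1 L, c.2) - prodState L f c)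
            + phase L (K1 L) c.2 * (prodState L f (c.1, c.2 - K1 L) - prodState L f c))
      = E12raw L f c + E12raw L f (c.2, c.1) + phase L (K1 L) c.1 * E12raw L f (c.2 - c.1, -c.1) := by
  -- canonical arguments
  have h1 : f (c.2 - K1 L - (c.1 - K1 L)) = f (c.2 - c.1) := congrArg f (by abel)
  have h2 : f (c.2 - (c.1 + K1 L)) = f (c.2 - c.1 - K1 L) := congrArg f (by abel)
  have h3 : f (c.2 + K1 L - c.1) = f (c.2 - c.1 + K1 L) := congrArg f (by abel)
  have h4 : f (c.2 + K1 L - (c.1 + K1 L)) = f (c.2 - c.1) := congrArg f (by abel)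
  have h5 : f (c.2 - (c.1 - K1 L)) = f (c.2 - c.1 + K1 L) := congrArg f (by abel)
  have h6 : f (c.2 - K1 L - c.1) = f (c.2 - c.1 - K1 L) := congrArg f (by abel)
  have e1 : f (c.1 - c.2) = f (c.2 - c.1) := by rw [← hev]; congr 1; abel
  have e2 : f (c.1 - c.2 + K1 L) = f (c.2 - c.1 - K1 L) := by rw [← hev]; congr 1; abel
  have e3 : f (c.1 - c.2 - K1 L) = f (c.2 - c.1 + K1 L) := by rw [← hev]; congr 1; abel
  have e4 : f (-c.1 - (c.2 - c.1)) = f c.2 := by rw [← hev]; congr 1; abel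
  have e5 : f (-c.1) = f c.1 := hev c.1
  have e6 : f (-c.1 - K1 L) = f (c.1 + K1 L) := by rw [← hev]; congr 1; abel
  have e7 : f (-c.1 - (c.2 - c.1) + K1 L) = f (c.2 - K1 L) := by rw [← hev]; congr 1; abel
  have e8 : f (-c.1 + K1 L) = f (c.1 - K1 L) := by rw [← hev]; congr 1; abel
  have e9 : f (-c.1 - (c.2 - c.1) - K1 L) = f (c.2 + K1 L) := by rw [← hev]; congr 1; abel
  simp only [E12raw, Aplus, Aminus, prodState, h1, h2, h3, h4, h5, h6, e1, e2, e3, e4, e5, e6, e7, e8, e9]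
  rw [← phase_sub_mul L (K1 L) c.2 c.1]
  push_cast
  ring

/-! ## Stage 3: the split of `R′` -/

/-- the off-`D` pair term `E₁₂ := 1_{Dᶜ} E⁰₁₂`. [folklore] -/
def E12 (f : Tor L → ℝ) (c : Cfg L) : ℂ := if InD L c then 0 else E12raw L f c

/-- **`R′ = v·C0′ + E₁₂ + E₁₃ + E₂₃`** with `E₁₃ = swap23 E₁₂`, `E₂₃ = U12 (swap23 E₁₂)` (`L ≥ 2`, ground profile). [folklore] -/
theorem resid_split (hL : 2 ≤ L) {Δ lam2 : ℝ} {f : Tor L → ℝ} (hf : IsGroundTwoMagnon L Δ lam2 f) (c : Cfg L) :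
    resid L Δ f c = vfun L c * C0p L Δ f c
      + (E12 L f c + swap23 L (E12 L f) c + U12 L (K1 L) (swap23 L (E12 L f)) c) := by
  have hev : ∀ r : Tor L, f (-r) = f r := hf.2.1
  have hsw : InD L (c.2, c.1) = InD L c := InD_swap L c
  have hro : InD L (c.2 - c.1, -c.1) = InD L c := InD_rot L c
  unfold resid residual C0p E12 swap23 U12
  simp only [hsw, hro]
  by_cases hD : InD L c = true
  · simp [hD]
  · have hD' : InD L c = false := by simpa using hD
    simp only [hD', Bool.false_eq_true, if_false]
    have h3 := threeMoves L hL f c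
    have hp := pairSplit_pointwise L hev c
    have ht : trialK1 L f c = vfun L c * prodState L f c := rfl
    unfold Happly
    push_cast
    linear_combination h3 + hp - ((Δ : ℂ) * (Wcount L c : ℂ) + (Tplus L Δ f : ℂ)) * ht

/-! ## Stage 4: norms -/

omit [NeZero L] in
/-- `|−½(x + y)|² ≤ (|x|² + |y|²)/2`. [folklore] -/
theorem normSq_half_sum_le (x y : ℂ) : Complex.normSq (-(1 / 2 : ℂ) * (x + y)) ≤ (Complex.normSq x + Complex.normSq y) / 2 := by
  have hq : Complex.normSq (-(1 / 2 : ℂ)) = 1 / 4 := by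
    rw [Complex.normSq_neg, show (1 / 2 : ℂ) = ((1 / 2 : ℝ) : ℂ) by push_cast; ring, Complex.normSq_ofReal]; norm_num
  rw [Complex.normSq_mul, hq]
  have hpar : Complex.normSq (x + y) + Complex.normSq (x - y) = 2 * (Complex.normSq x + Complex.normSq y) := by
    rw [Complex.normSq_add, Complex.normSq_sub]; ring
  nlinarith [Complex.normSq_nonneg (x - y)]

/-- **`‖E₁₂‖² ≤ cs2`** (Cauchy–Schwarz over the two groups). [folklore] -/
theorem sum_normSq_E12_le (f : Tor L → ℝ) : ∑ c : Cfg L, Complex.normSq (E12 L f c) ≤ cs2 L f := by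
  unfold cs2 E12
  apply Finset.sum_le_sum
  intro c _
  by_cases hD : InD L c = true
  · simp [hD]
  · have hD' : InD L c = false := by simpa using hD
    simp only [hD', Bool.false_eq_true, if_false]
    unfold E12raw
    refine (normSq_half_sum_le _ _).trans ?_
    rw [Complex.normSq_mul, Complex.normSq_mul, Complex.normSq_ofReal, Complex.normSq_ofReal]
    apply le_of_eq
    ring

/-- `swap23` preserves the norm. [folklore] -/
theorem sum_normSq_swap23 (F : Cfg L → ℂ) :
    ∑ c : Cfg L, Complex.normSq (swap23 L F c) = ∑ c : Cfg L, Complex.normSq (F c) :=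
  Fintype.sum_equiv (Equiv.prodComm _ _) _ _ (fun _ => rfl)

/-- the involution `(a, b) ↦ (−a, b − a)` of `Cfg`. [folklore] -/
def rotEquiv : Cfg L ≃ Cfg L where
  toFun c := (-c.1, c.2 - c.1)
  invFun c := (-c.1, c.2 - c.1)
  left_inv c := by
    obtain ⟨a, b⟩ := c
    simp only [neg_neg, Prod.mk.injEq, true_and]
    abel
  right_inv c := by
    obtain ⟨a, b⟩ := c
    simp only [neg_neg, Prod.mk.injEq, true_and]
    abel

/-- `U12 K` preserves the norm. [folklore] -/
theorem sum_normSq_U12 (K : Tor L) (F : Cfg L → ℂ) :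
    ∑ c : Cfg L, Complex.normSq (U12 L K F c) = ∑ c : Cfg L, Complex.normSq (F c) := by
  have h : ∀ c : Cfg L, Complex.normSq (U12 L K F c) = Complex.normSq (F (rotEquiv L c)) := by
    intro c
    simp only [U12, Complex.normSq_mul, normSq_phase, one_mul]
    rfl
  rw [Finset.sum_congr rfl fun c _ => h c]
  exact Fintype.sum_equiv (rotEquiv L) _ _ (fun _ => rfl)

/-- the triangle inequality for the `ℓ²` norm on `Cfg → ℂ`. [folklore] -/
theorem sqrt_sum_norm_sq_add_le (F G : Cfg L → ℂ) :
    Real.sqrt (∑ c : Cfg L, ‖F c + G c‖ ^ 2)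
      ≤ Real.sqrt (∑ c : Cfg L, ‖F c‖ ^ 2) + Real.sqrt (∑ c : Cfg L, ‖G c‖ ^ 2) := by
  set A := ∑ c : Cfg L, ‖F c‖ ^ 2 with hA
  set B := ∑ c : Cfg L, ‖G c‖ ^ 2 with hB
  have hA0 : 0 ≤ A := Finset.sum_nonneg fun c _ => by positivity
  have hB0 : 0 ≤ B := Finset.sum_nonneg fun c _ => by positivity
  have hcs : ∑ c : Cfg L, ‖F c‖ * ‖G c‖ ≤ Real.sqrt A * Real.sqrt B := Real.sum_mul_le_sqrt_mul_sqrt _ _ _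
  have hpt : ∀ c : Cfg L, ‖F c + G c‖ ^ 2 ≤ ‖F c‖ ^ 2 + ‖G c‖ ^ 2 + 2 * (‖F c‖ * ‖G c‖) := by
    intro c
    have h := norm_add_le (F c) (G c)
    nlinarith [norm_nonneg (F c + G c), norm_nonneg (F c), norm_nonneg (G c)]
  have hsum : ∑ c : Cfg L, ‖F c + G c‖ ^ 2 ≤ A + B + 2 * (Real.sqrt A * Real.sqrt B) := by
    calc ∑ c : Cfg L, ‖F c + G c‖ ^ 2 ≤ ∑ c : Cfg L, (‖F c‖ ^ 2 + ‖G c‖ ^ 2 + 2 * (‖F c‖ * ‖G c‖)) :=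
          Finset.sum_le_sum fun c _ => hpt c
      _ = A + B + 2 * ∑ c : Cfg L, ‖F c‖ * ‖G c‖ := by
          rw [Finset.sum_add_distrib, Finset.sum_add_distrib, ← Finset.mul_sum]
      _ ≤ A + B + 2 * (Real.sqrt A * Real.sqrt B) := by linarith
  have hsq : A + B + 2 * (Real.sqrt A * Real.sqrt B) = (Real.sqrt A + Real.sqrt B) ^ 2 := by
    rw [add_sq, Real.sq_sqrt hA0, Real.sq_sqrt hB0]; ring
  rw [hsq] at hsum
  calc Real.sqrt (∑ c : Cfg L, ‖F c + G c‖ ^ 2) ≤ Real.sqrt ((Real.sqrt A + Real.sqrt B) ^ 2) := Real.sqrt_le_sqrt hsum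
    _ = Real.sqrt A + Real.sqrt B := Real.sqrt_sq (by positivity)

/-- `Σ normSq = Σ ‖·‖²`. [folklore] -/
theorem sum_normSq_eq_sum_norm_sq (F : Cfg L → ℂ) :
    ∑ c : Cfg L, Complex.normSq (F c) = ∑ c : Cfg L, ‖F c‖ ^ 2 :=
  Finset.sum_congr rfl fun c _ => Complex.normSq_eq_norm_sq (F c)

/-! ## Stage 5: `PairSplitCS` -/

/-- ★ **`PairSplitCS L Δ` holds** (`L ≥ 2`): `‖R′‖² ≤ (3√cs2 + ‖N‖)²`. [folklore] -/
theorem pairSplitCS_holds (hL : 2 ≤ L) (Δ : ℝ) : PairSplitCS L Δ := by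
  intro lam2 f hf _
  -- the four pieces
  set N : Cfg L → ℂ := fun c => vfun L c * C0p L Δ f c with hN
  set E1 : Cfg L → ℂ := E12 L f with hE1
  set E2 : Cfg L → ℂ := swap23 L (E12 L f) with hE2
  set E3 : Cfg L → ℂ := U12 L (K1 L) (swap23 L (E12 L f)) with hE3
  have hR : ∀ c : Cfg L, resid L Δ f c = N c + ((E1 c + E2 c) + E3 c) := by
    intro c; rw [resid_split L hL hf c]
  -- norms
  have hnrm : ∀ F : Cfg L → ℂ, 0 ≤ Real.sqrt (∑ c : Cfg L, ‖F c‖ ^ 2) := fun F => Real.sqrt_nonneg _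
  have hE1n : Real.sqrt (∑ c : Cfg L, ‖E1 c‖ ^ 2) ≤ Real.sqrt (cs2 L f) := by
    apply Real.sqrt_le_sqrt; rw [← sum_normSq_eq_sum_norm_sq]; exact sum_normSq_E12_le L f
  have hE2n : Real.sqrt (∑ c : Cfg L, ‖E2 c‖ ^ 2) ≤ Real.sqrt (cs2 L f) := by
    apply Real.sqrt_le_sqrt; rw [← sum_normSq_eq_sum_norm_sq, hE2, sum_normSq_swap23]; exact sum_normSq_E12_le L f
  have hE3n : Real.sqrt (∑ c : Cfg L, ‖E3 c‖ ^ 2) ≤ Real.sqrt (cs2 L f) := by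
    apply Real.sqrt_le_sqrt; rw [← sum_normSq_eq_sum_norm_sq, hE3, sum_normSq_U12, sum_normSq_swap23]
    exact sum_normSq_E12_le L f
  have hNn : Real.sqrt (∑ c : Cfg L, ‖N c‖ ^ 2) = Real.sqrt (nNterm L Δ f) := by
    unfold nNterm; rw [sum_normSq_eq_sum_norm_sq]
  -- triangle inequality
  have htri : Real.sqrt (∑ c : Cfg L, ‖resid L Δ f c‖ ^ 2)
      ≤ Real.sqrt (nNterm L Δ f) + 3 * Real.sqrt (cs2 L f) := by
    have h0 := sqrt_sum_norm_sq_add_le L N (fun c => (E1 c + E2 c) + E3 c)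
    have h1 := sqrt_sum_norm_sq_add_le L (fun c => E1 c + E2 c) E3
    have h2 := sqrt_sum_norm_sq_add_le L E1 E2
    rw [Finset.sum_congr rfl fun c _ => by rw [hR c], ← hNn]
    linarith
  -- square
  rw [ip_self_re]
  have hS : 0 ≤ ∑ c : Cfg L, ‖resid L Δ f c‖ ^ 2 := Finset.sum_nonneg fun c _ => by positivity
  have hsq : ∑ c : Cfg L, ‖resid L Δ f c‖ ^ 2 = Real.sqrt (∑ c : Cfg L, ‖resid L Δ f c‖ ^ 2) ^ 2 :=
    (Real.sq_sqrt hS).symm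
  rw [hsq]
  have hpos := hnrm (resid L Δ f)
  have hrhs : 0 ≤ 3 * Real.sqrt (cs2 L f) + Real.sqrt (nNterm L Δ f) := by positivity
  nlinarith

end Summit.HubbardSuperconductivity.HubbardSuperconductivity.Theorems.AnisotropyChord.Transfer.Fibre3

end
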